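import Literature.Computability.AlgebraicComplexity.LMR13BoundaryMaximality
import Literature.Computability.AlgebraicComplexity.LMR13ZariskiTangentProofs
import Literature.Computability.AlgebraicComplexity.LMR13FirstOrderIdentity
import Literature.RingTheory.KrullDimension.TangentDimension
import Literature.RingTheory.KrullDimension.AffineCatenary
import HarnessLib

/-!
# LMR 2013 Thm. 3.1.1: "irreducible component" from the Zariski tangent space

Landsberg–Manivel–Ressayre 2013, Thm. 3.1.1 (journal p. 476; arXiv:1004.4802 `p0006.txt:L32–34`):
"The scheme `𝒟ual_{2n−2,n,n²}` is smooth at `[det_n]`, and the `PGL_{n²}`-orbit closure of `[det_n]` is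
an irreducible component of `𝒟ual_{2n−2,n,n²}`." The printed proof (p. 480, arXiv `p0008.txt:L39–43`)
computes the Zariski tangent space `T̂_{[det_n]}𝒟ual = 𝔤𝔩(W)·det_n` and says the theorem
"immediately follows". In the tree the named fact `LMR2013_thm_3_1_1` is already EQUIVALENT to
`T̂ ⊆ 𝔤𝔩(W)·det_n` ∧ (maximality of `Δ(det_n)` among the irreducible subsets of `𝒟ual`)
(`LMR2013_thm_3_1_1_iff`, `LMR13ZariskiTangentProofs.lean`).

This file PROVES the "immediately follows": the maximality clause FROM the tangent-space inclusion,
so that `LMR2013_thm_3_1_1 ↔ ∀ n ≥ 3, T̂_{[det_n]}𝒟ual_{2n−2,n,n²} ⊆ 𝔤𝔩(W)·det_n`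
(`LMR2013_thm_3_1_1_iff_lmrZariskiTangent_subset`), by dimension theory:

* `affineDimension_formCoeff_le_finrank_tangentSpaceAt` — for an irreducible set `S` of forms and any
  `s₀ ∈ S`, `dim S ≤ dim_ℂ T_{s₀} S` (Springer 4.3.3 (iii) "`dim_k T_x X ≥ dim X`": the tree's
  `height_le_finrank_tangentSpaceAt` + the catenary identity `dim (A⧸𝔪) + ht 𝔪 = dim A` of
  `AffineCatenary.lean`);
* `exists_lmrDualEquation_coordPoly` — each equation `E_{B,u,v}` of §2.3 is a polynomial `Φ` in the
  degree-`d` coefficients (generic form `genericFormDeg`, base change `map_lmrDualEquation`), and its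
  differential at `P` along `π` is the `ε`-coefficient of `E(P + επ)` (`coeff_one_aeval_affineLine`),
  so `T_{P} S ⊆ formCoeff (T̂_{[P]}𝒟ual)` for `S ⊆ 𝒟ual` (`finrank_tangentSpaceAt_le_finrank_glTangent`);
* with `dim Δ(det_n) = dim 𝔤𝔩(W)·det_n` (`affineDimension_orbitClosure_eq_finrank_glTangent`) and
  `subset_orbitClosure_of_affineDimension_le`: an irreducible `S' ⊇ Δ(det_n)` inside `𝒟ual` has
  `dim S' ≤ dim T_{det_n} S' ≤ dim T̂ ≤ dim 𝔤𝔩(W)·det_n = dim Δ(det_n)`, hence `S' ⊆ Δ(det_n)`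
  (`orbitClosure_detPoly_maximal_of_lmrZariskiTangent_subset`).

Theorem-only; no definitions, no named facts. Honest framing: this reduces the typed Thm. 3.1.1 to its
tangent-space inclusion (LMR Lemmas 3.3.1–3.4.1 / Prop. 3.4.2, in flight elsewhere in the tree);
VP ≠ VNP is NOT proved and nothing here is progress on it.

## References

* [LandsbergManivelRessayre2013] Comment. Math. Helv. 88 (2013), Thm. 3.1.1 (p. 476, proof p. 480).
* [SpringerLAG1998] T. A. Springer, *Linear Algebraic Groups*, 2nd ed., 4.1.2, Thm. 4.3.3 (iii).
* [Hartshorne1977] *Algebraic Geometry*, I §1 Ex. 1.10 (d).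
-/

noncomputable section

namespace Literature.Computability.AlgebraicComplexity

open MvPolynomial Literature.RingTheory.KrullDimension

/-! ### `dim S ≤ dim T_{s₀} S` for irreducible sets of forms -/

section TangentBound

variable {σ : Type*} [Fintype σ] [DecidableEq σ]

/-- **`dim X ≤ dim_k T_x X` at every point of an irreducible affine variety** (Springer 4.3.3 (iii)),
for an irreducible set `S` of forms read in degree-`n` coefficient space and the coordinate tangent
space `tangentSpaceAt I(S) (formCoeff n s₀)` (Springer 4.1.2): `I(S)` is prime, the height of the
maximal ideal of `s₀` in the affine domain `ℂ[Sym^n] ⧸ I(S)` is `dim S` (catenary identity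
`ringKrullDim_quotient_add_height`), and it is at most `dim T` (`height_le_finrank_tangentSpaceAt`).
[cite: SpringerLAG1998, Thm 4.3.3 (iii)] -/
theorem affineDimension_formCoeff_le_finrank_tangentSpaceAt {S : Set (MvPolynomial σ ℂ)}
    (hS : IsCoeffZariskiIrreducible S) (n : ℕ) {s₀ : MvPolynomial σ ℂ} (hs₀ : s₀ ∈ S) :
    affineDimension (formCoeff n '' S) ≤ Module.finrank ℂ
      (tangentSpaceAt (MvPolynomial.vanishingIdeal ℂ (formCoeff n '' S)) (formCoeff n s₀)) := by
  classical
  set I := MvPolynomial.vanishingIdeal ℂ (formCoeff n '' S) with hI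
  haveI : I.IsPrime := isPrime_vanishingIdeal_formCoeff_image hS n
  haveI : IsDomain (MvPolynomial (DegIdx σ n) ℂ ⧸ I) := Ideal.Quotient.isDomain I
  have ha : ∀ f ∈ I, eval (formCoeff n s₀) f = 0 := fun f hf => by
    rw [← aeval_apply_eq_eval]
    exact (MvPolynomial.mem_vanishingIdeal_iff.mp hf) _ ⟨s₀, hs₀, rfl⟩
  have hheight := height_le_finrank_tangentSpaceAt I (formCoeff n s₀) ha
  set 𝔪 := pointIdeal (pointOfZero I (formCoeff n s₀) ha) with h𝔪
  haveI : 𝔪.IsMaximal := isMaximal_pointIdeal _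
  have hcat := ringKrullDim_quotient_add_height (F := ℂ) 𝔪
  letI : Field ((MvPolynomial (DegIdx σ n) ℂ ⧸ I) ⧸ 𝔪) := Ideal.Quotient.field 𝔪
  rw [ringKrullDim_eq_zero_of_field ((MvPolynomial (DegIdx σ n) ℂ ⧸ I) ⧸ 𝔪), zero_add] at hcat
  obtain ⟨t, ht, -⟩ := exists_ringKrullDim_eq_and_trdeg_eq ℂ (MvPolynomial (DegIdx σ n) ℂ ⧸ I)
  rw [ht] at hcat
  -- `𝔪.height = t`
  have hfin : 𝔪.height ≠ ⊤ := by
    intro h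
    rw [h, ← WithBot.coe_natCast] at hcat
    exact ENat.top_ne_coe t (WithBot.coe_inj.mp hcat)
  obtain ⟨m, hm⟩ := ENat.ne_top_iff_exists.mp hfin
  have hmt : m = t := by
    rw [← hm, ← WithBot.coe_natCast] at hcat
    exact_mod_cast hcat
  have hmle : (m : ℕ∞) ≤ Module.finrank ℂ (tangentSpaceAt I (formCoeff n s₀)) := by
    rw [hm]; exact hheight
  have hmle' : m ≤ Module.finrank ℂ (tangentSpaceAt I (formCoeff n s₀)) := by exact_mod_cast hmle
  unfold affineDimension
  rw [← hI, ht, ← WithBot.coe_natCast, WithBot.unbotD_coe, ENat.toNat_coe, ← hmt]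
  exact hmle'

end TangentBound

/-! ### The equations of `𝒟ual` as polynomials in the coefficients, and their differentials -/

section Equations

variable {σ : Type*} [Fintype σ] [DecidableEq σ]

/-- A form of degree `d` is the sum of its degree-`d` monomial terms, written with `monomial`.
[cite: MulmuleySohoniSIAM2001, §4] -/
private theorem eq_sum_monomial_coeff {d : ℕ} {h : MvPolynomial σ ℂ} (hh : h.IsHomogeneous d) :
    h = ∑ δ : DegIdx σ d, monomial δ.1 (coeff δ.1 h) := by
  conv_lhs => rw [← map_eval_formCoeff_genericFormDeg hh]
  rw [map_eval_genericFormDeg]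
  rfl

/-- The coefficient vector of `∑_δ v_δ x^δ` is `v`. [cite: MulmuleySohoniSIAM2001, §4] -/
private theorem formCoeff_sum_monomial {d : ℕ} (v : DegIdx σ d → ℂ) :
    formCoeff d (∑ δ : DegIdx σ d, monomial δ.1 (v δ)) = v := by
  classical
  funext δ₀
  rw [formCoeff_apply, coeff_sum, Finset.sum_eq_single δ₀]
  · rw [coeff_monomial, if_pos rfl]
  · intro δ _ hδ
    rw [coeff_monomial, if_neg (fun h => hδ (Subtype.ext h))]
  · intro h; exact absurd (Finset.mem_univ δ₀) h

/-- `∑_δ v_δ x^δ` is a form of degree `d`. [cite: MulmuleySohoniSIAM2001, §4] -/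
private theorem isHomogeneous_sum_monomial {d : ℕ} (v : DegIdx σ d → ℂ) :
    (∑ δ : DegIdx σ d, monomial δ.1 (v δ)).IsHomogeneous d := by
  refine IsHomogeneous.sum _ _ _ fun δ _ => ?_
  exact isHomogeneous_monomial _ (mem_degMonomials_iff.mp δ.2)

/-- **The equations `E_{B,u,v}` of §2.3 are polynomial functions of the coefficients**, with the
expected differential: there is `Φ ∈ ℂ[Sym^d]` with `Φ(P) = E_{B,u,v}(P)` for every form `P` of degree
`d`, and `∑_δ π_δ (∂Φ/∂X_δ)(P) = ` the `ε`-coefficient of `E_{B,u,v}(P + επ)` for forms `P, π` of degree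
`d` (generic form `genericFormDeg`, base change `map_lmrDualEquation`, first-order Taylor
`coeff_one_aeval_affineLine`). LMR §2.2: "considered as a polynomial equation in the coefficients of
`P`"; §3.3: "We differentiate the condition". [cite: LandsbergManivelRessayre2013, §2.2–§3.3 (pp. 473–477)] -/
theorem exists_lmrDualEquation_coordPoly (κ d : ℕ) (B : Matrix (Fin (κ + 3)) σ ℂ) (u v : σ → ℂ) :
    ∃ Φ : MvPolynomial (DegIdx σ d) ℂ,
      (∀ P : MvPolynomial σ ℂ, P.IsHomogeneous d →
        eval (formCoeff d P) Φ = lmrDualEquation κ d B u v P) ∧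
      (∀ P π : MvPolynomial σ ℂ, P.IsHomogeneous d → π.IsHomogeneous d →
        ∑ i, formCoeff d π i * eval (formCoeff d P) (pderiv i Φ) =
          (lmrDualEquation κ d (B.map (Polynomial.C : ℂ →+* Polynomial ℂ))
            (fun i => Polynomial.C (u i)) (fun i => Polynomial.C (v i))
            (firstOrderDeformation P π)).coeff 1) := by
  classical
  set R := MvPolynomial (DegIdx σ d) ℂ with hR
  set Φ : R := lmrDualEquation κ d (B.map (C : ℂ →+* R)) (fun i => C (u i)) (fun i => C (v i))
    (genericFormDeg σ ℂ d) with hΦ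
  refine ⟨Φ, fun P hP => ?_, fun P π hP hπ => ?_⟩
  · rw [hΦ, map_lmrDualEquation (eval (formCoeff d P)), Matrix.map_map,
      map_eval_formCoeff_genericFormDeg hP]
    have hB : B.map (⇑(eval (formCoeff d P)) ∘ ⇑(C : ℂ →+* R)) = B := by
      ext i j; rw [Matrix.map_apply, Function.comp_apply, eval_C]
    simp only [hB, eval_C]
  · -- first-order Taylor of `Φ` along `formCoeff P + X · formCoeff π`
    rw [← coeff_one_aeval_affineLine (formCoeff d P) (formCoeff d π) Φ]
    set ψ : R →ₐ[ℂ] Polynomial ℂ :=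
      aeval fun i => Polynomial.C (formCoeff d P i) + Polynomial.C (formCoeff d π i) * Polynomial.X
      with hψ
    have hψC : ∀ c : ℂ, ψ (C c) = Polynomial.C c := fun c => by
      rw [hψ, aeval_C, Polynomial.algebraMap_eq]
    have h1 : ψ Φ = lmrDualEquation κ d ((B.map (C : ℂ →+* R)).map (ψ : R →+* Polynomial ℂ))
        (fun i => (ψ : R →+* Polynomial ℂ) (C (u i))) (fun i => (ψ : R →+* Polynomial ℂ) (C (v i)))
        (map (ψ : R →+* Polynomial ℂ) (genericFormDeg σ ℂ d)) := by
      rw [hΦ, ← map_lmrDualEquation (ψ : R →+* Polynomial ℂ)]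
      rfl
    have hB : (B.map (C : ℂ →+* R)).map (ψ : R →+* Polynomial ℂ) =
        B.map (Polynomial.C : ℂ →+* Polynomial ℂ) := by
      ext i j
      rw [Matrix.map_map, Matrix.map_apply, Matrix.map_apply, Function.comp_apply, RingHom.coe_coe,
        hψC]
    have hG : map (ψ : R →+* Polynomial ℂ) (genericFormDeg σ ℂ d) = firstOrderDeformation P π := by
      rw [genericFormDeg, map_sum, firstOrderDeformation]
      conv_rhs => rw [eq_sum_monomial_coeff hP, eq_sum_monomial_coeff hπ, map_sum, map_sum,
        Finset.mul_sum, ← Finset.sum_add_distrib]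
      refine Finset.sum_congr rfl fun δ _ => ?_
      rw [map_monomial, map_monomial, map_monomial, RingHom.coe_coe, hψ, aeval_X, C_mul_monomial,
        ← map_add]
      congr 1
      rw [formCoeff_apply, formCoeff_apply, mul_comm]
    rw [show (aeval fun i => Polynomial.C (formCoeff d P i) + Polynomial.C (formCoeff d π i) *
        Polynomial.X) Φ = ψ Φ from rfl, h1, hB, hG]
    simp only [RingHom.coe_coe, hψC]

/-- **`T_P S ⊆ formCoeff (T̂_{[P]} 𝒟ual)`**: for `S ⊆ 𝒟ual_{k,d,N}` and `P ∈ S`, every coordinate tangent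
vector of `S` at `P` is the coefficient vector of a form in the affine Zariski tangent space
`lmrZariskiTangent k d P` (the equations vanish on `S`, so their differentials vanish on `T_P S`); hence,
when `T̂_{[P]} 𝒟ual ⊆ 𝔤𝔩(W)·P`, `dim T_P S ≤ dim 𝔤𝔩(W)·P`. [cite: LandsbergManivelRessayre2013, §3.3 (p. 477)] -/
theorem finrank_tangentSpaceAt_le_finrank_glTangent {κ d : ℕ} {S : Set (MvPolynomial σ ℂ)}
    {P : MvPolynomial σ ℂ} (hS : S ⊆ lmrDualScheme κ d) (hP : P ∈ S)
    (hT : lmrZariskiTangent κ d P ⊆ ↑(glTangent P)) :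
    Module.finrank ℂ (tangentSpaceAt (MvPolynomial.vanishingIdeal ℂ (formCoeff d '' S))
        (formCoeff d P)) ≤ Module.finrank ℂ (glTangent P) := by
  classical
  haveI := glTangent_finiteDimensional P
  have hPd : P.IsHomogeneous d := (hS hP).1
  set I := MvPolynomial.vanishingIdeal ℂ (formCoeff d '' S) with hI
  -- the linear map `v ↦ ∑_δ v_δ x^δ`
  set G : (DegIdx σ d → ℂ) →ₗ[ℂ] MvPolynomial σ ℂ :=
    Fintype.linearCombination ℂ fun δ : DegIdx σ d => (monomial δ.1 (1 : ℂ) : MvPolynomial σ ℂ)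
    with hG
  have hGapply : ∀ w : DegIdx σ d → ℂ, G w = ∑ δ : DegIdx σ d, monomial δ.1 (w δ) := by
    intro w
    rw [hG, Fintype.linearCombination_apply]
    exact Finset.sum_congr rfl fun δ _ => by rw [smul_monomial, smul_eq_mul, mul_one]
  -- every tangent vector gives a first-order tangent form
  have hmem : ∀ w ∈ tangentSpaceAt I (formCoeff d P), G w ∈ glTangent P := by
    intro w hw
    apply hT
    refine ⟨by rw [hGapply]; exact isHomogeneous_sum_monomial w, fun B u v => ?_⟩
    obtain ⟨Φ, hΦ0, hΦ1⟩ := exists_lmrDualEquation_coordPoly κ d B u v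
    have hΦI : Φ ∈ I := by
      rw [hI, MvPolynomial.mem_vanishingIdeal_iff]
      rintro _ ⟨s, hs, rfl⟩
      rw [aeval_apply_eq_eval, hΦ0 s (hS hs).1]
      exact (hS hs).2 B u v
    rw [← hΦ1 P (G w) hPd (by rw [hGapply]; exact isHomogeneous_sum_monomial w), hGapply,
      formCoeff_sum_monomial]
    rw [mem_tangentSpaceAt_iff] at hw
    rw [← hw Φ hΦI]
    exact Finset.sum_congr rfl fun i _ => mul_comm _ _
  set F : ↥(tangentSpaceAt I (formCoeff d P)) →ₗ[ℂ] ↥(glTangent P) :=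
    LinearMap.codRestrict (glTangent P) (G ∘ₗ (tangentSpaceAt I (formCoeff d P)).subtype)
      (fun w => hmem w w.2) with hF
  have hFinj : Function.Injective F := by
    intro w w' h
    have h' : G w = G w' := by
      have := congrArg Subtype.val h
      simpa [hF] using this
    apply Subtype.ext
    have h'' := congrArg (formCoeff d) h'
    rwa [hGapply, hGapply, formCoeff_sum_monomial, formCoeff_sum_monomial] at h''
  exact LinearMap.finrank_le_finrank_of_injective hFinj

end Equations

/-! ### Thm. 3.1.1: the component clause from the tangent-space inclusion -/

section Component

variable {n : ℕ}

/-- `det_n` is a form of degree `n`. [cite: Burgisser2000, §2.1] -/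
private theorem detPoly_fin_isHomogeneous'' (n : ℕ) : (detPoly (Fin n) ℂ).IsHomogeneous n := by
  have h := detPoly_isHomogeneous (n := Fin n) (k := ℂ)
  rwa [Fintype.card_fin] at h

/-- **Maximality of `Δ(det_n)` in `𝒟ual_{2n−2,n,n²}` from `T̂_{[det_n]}𝒟ual ⊆ 𝔤𝔩(W)·det_n`** — the
"immediately follows" of LMR 2013 (p. 480): an irreducible `S'` with `Δ(det_n) ⊆ S' ⊆ 𝒟ual` has
`dim S' ≤ dim T_{det_n} S' ≤ dim 𝔤𝔩(W)·det_n = dim Δ(det_n)`, hence `S' ⊆ Δ(det_n)`.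
[cite: LandsbergManivelRessayre2013, Theorem 3.1.1 (p. 476, proof p. 480)] -/
theorem orbitClosure_detPoly_maximal_of_lmrZariskiTangent_subset
    (hT : lmrZariskiTangent (2 * n - 2) n (detPoly (Fin n) ℂ) ⊆ ↑(glTangent (detPoly (Fin n) ℂ))) :
    ∀ S' : Set (MvPolynomial (Fin n × Fin n) ℂ), IsCoeffZariskiIrreducible S' →
      orbitClosure (detPoly (Fin n) ℂ) ⊆ S' →
        S' ⊆ lmrDualScheme (σ := Fin n × Fin n) (2 * n - 2) n →
          S' ⊆ orbitClosure (detPoly (Fin n) ℂ) := by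
  intro S' hS' hΔS' hS'D
  have hD : (detPoly (Fin n) ℂ).IsHomogeneous n := detPoly_fin_isHomogeneous'' n
  have hD0 : detPoly (Fin n) ℂ ≠ 0 := Matrix.det_mvPolynomialX_ne_zero (Fin n) ℂ
  have hdet : detPoly (Fin n) ℂ ∈ S' := hΔS' (mem_orbitClosure_self _)
  have h1 := affineDimension_formCoeff_le_finrank_tangentSpaceAt hS' n hdet
  have h2 := finrank_tangentSpaceAt_le_finrank_glTangent hS'D hdet hT
  refine subset_orbitClosure_of_affineDimension_le hD hD0 hS' (fun s hs => (hS'D hs).1) hΔS' ?_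
  rw [affineDimension_orbitClosure_eq_finrank_glTangent hD]
  exact h1.trans h2

/-- **General form: an orbit closure inside `𝒟ual_{k,d,N}` whose Zariski tangent space is the orbit
tangent space is an irreducible component of `𝒟ual_{k,d,N}`** (the mechanism of LMR 2013 Thm. 3.1.1,
for any non-zero form `P` of degree `d`: irreducible `S'` with `Δ(P) ⊆ S' ⊆ 𝒟ual_{k,d}` and
`T̂_{[P]}𝒟ual_{k,d} ⊆ 𝔤𝔩(W)·P` force `S' ⊆ Δ(P)`, since `dim S' ≤ dim T_P S' ≤ dim 𝔤𝔩(W)·P = dim Δ(P)`).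
[cite: LandsbergManivelRessayre2013, Theorem 3.1.1 (p. 476, proof p. 480)] -/
theorem orbitClosure_maximal_of_lmrZariskiTangent_subset {σ : Type*} [Fintype σ] [DecidableEq σ]
    {κ d : ℕ} {P : MvPolynomial σ ℂ} (hP : P.IsHomogeneous d) (hP0 : P ≠ 0)
    (hT : lmrZariskiTangent κ d P ⊆ ↑(glTangent P)) :
    ∀ S' : Set (MvPolynomial σ ℂ), IsCoeffZariskiIrreducible S' → orbitClosure P ⊆ S' →
      S' ⊆ lmrDualScheme κ d → S' ⊆ orbitClosure P := by
  intro S' hS' hΔS' hS'D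
  have hPS : P ∈ S' := hΔS' (mem_orbitClosure_self _)
  have h1 := affineDimension_formCoeff_le_finrank_tangentSpaceAt hS' d hPS
  have h2 := finrank_tangentSpaceAt_le_finrank_glTangent hS'D hPS hT
  refine subset_orbitClosure_of_affineDimension_le hP hP0 hS' (fun s hs => (hS'D hs).1) hΔS' ?_
  rw [affineDimension_orbitClosure_eq_finrank_glTangent hP]
  exact h1.trans h2

/-- **LMR 2013 Thm. 3.1.1 from its tangent-space inclusion**: the named fact `LMR2013_thm_3_1_1`
follows from `T̂_{[det_n]}𝒟ual_{2n−2,n,n²} ⊆ 𝔤𝔩_{n²}·det_n` for all `n ≥ 3` — the component clause is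
no longer a separate input (`LMR2013_thm_3_1_1_iff` + `orbitClosure_detPoly_maximal_of_lmrZariskiTangent_subset`).
[cite: LandsbergManivelRessayre2013, Theorem 3.1.1 (p. 476)] -/
theorem LMR2013_thm_3_1_1_of_lmrZariskiTangent_subset
    (h : ∀ n : ℕ, 3 ≤ n →
      lmrZariskiTangent (2 * n - 2) n (detPoly (Fin n) ℂ) ⊆ ↑(glTangent (detPoly (Fin n) ℂ))) :
    LMR2013_thm_3_1_1 :=
  LMR2013_thm_3_1_1_iff.mpr fun n hn =>
    ⟨h n hn, orbitClosure_detPoly_maximal_of_lmrZariskiTangent_subset (h n hn)⟩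

/-- **Thm. 3.1.1 ⟺ the tangent-space inclusion** `T̂_{[det_n]}𝒟ual_{2n−2,n,n²} ⊆ 𝔤𝔩_{n²}·det_n`
(all `n ≥ 3`): what remains of the named fact is exactly its printed "smoothness" computation
(LMR Lemmas 3.3.1, 3.3.2, 3.4.1 / Prop. 3.4.2). [cite: LandsbergManivelRessayre2013, Theorem 3.1.1 (p. 476, proof pp. 477–480)] -/
theorem LMR2013_thm_3_1_1_iff_lmrZariskiTangent_subset :
    LMR2013_thm_3_1_1 ↔ ∀ n : ℕ, 3 ≤ n →
      lmrZariskiTangent (2 * n - 2) n (detPoly (Fin n) ℂ) ⊆ ↑(glTangent (detPoly (Fin n) ℂ)) :=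
  ⟨fun h n hn => (LMR2013_thm_3_1_1_iff.mp h n hn).1, LMR2013_thm_3_1_1_of_lmrZariskiTangent_subset⟩

end Component

end Literature.Computability.AlgebraicComplexity
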